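import Literature.Geometry.Riemannian.ConstantCurvatureRicci
import Literature.Geometry.Riemannian.HyperbolicBallCompactification
import Literature.Geometry.Riemannian.RoundSphere
import Literature.Geometry.Riemannian.RiemannianDistance
import Literature.Geometry.Lorentzian.Hypersurface
import Literature.Geometry.Lorentzian.IsometryProofs
import Literature.Topology.FourManifolds.ClosedBallTangent
import Literature.Topology.FourManifolds.ClosedBallSmoothEmbeddings
import Literature.Topology.FourManifolds.InteriorSmoothEmbedding
import Literature.Topology.FourManifolds.ImmersionCriterion
import Literature.Geometry.Manifold.OpenSubmanifoldMFDeriv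

/-!
# Crux `PEFillNearRound` (stmt-SmoothPoincare4-7997), line `Sketch`, helper piece `helper_rf_interiorEmbedding` of
# `helper_roundFilled` (the round `S⁴` bounds hyperbolic `5`-space = route item
# `EinsteinBulk.RoundSphereBoundsHyperbolicSpace`, the base point of `stub_peFillStandard`)

The interior embedding: the compactification map `j = x = ξ/(1+τ)` (`Hyperboloid.ballMap`) of hyperbolic space (graph chart on all of `ℝ⁵`) is a smooth embedding of the boundaryless `ℝ⁵` into the manifold with boundary `𝔻⁵`, onto its interior (the open ball).
-/

noncomputable section

-- the prescribed namespace `Summit.<P>.<Sub>.…` duplicates `SmoothPoincare4` (P = Sub)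
set_option linter.dupNamespace false

open scoped Manifold ContDiff Topology RealInnerProductSpace
open Set Function Metric Bundle TopologicalSpace
open Literature.Geometry.Lorentzian Literature.Geometry.Lorentzian.PseudoRiemannianMetric
open Literature.Geometry.Riemannian Literature.Topology.FourManifolds
open Literature.Geometry.Manifold

namespace Summit.SmoothPoincare4.SmoothPoincare4.Cruxes.PEFillNearRound.RoundFilled

/-- **The compactification map `ballMap` is a topological embedding** of `V` into itself: it is
continuous, injective, and open (its image of an open set `U` is the trace on the open unit ball
of the preimage of `U` under the continuous left inverse `x ↦ (2/(1-‖x‖²)) • x`, Lee 2018,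
(3.14)). [cite: Lee2018, Thm. 3.7 (c) and (3.14)] -/
private theorem isEmbedding_ballMap {V : Type*} [NormedAddCommGroup V] [InnerProductSpace ℝ V] :
    Topology.IsEmbedding (Hyperboloid.ballMap : V → V) := by
  have hc : Continuous (Hyperboloid.ballMap : V → V) := Hyperboloid.contDiff_ballMap.continuous
  have ho : IsOpenMap (Hyperboloid.ballMap : V → V) := by
    intro U hU
    have hg : ContinuousOn (fun x : V => (2 / (1 - ‖x‖ ^ 2)) • x) (Metric.ball 0 1) := by
      refine ContinuousOn.smul (continuousOn_const.div ?_ ?_) continuousOn_id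
      · exact (continuous_const.sub (continuous_norm.pow 2)).continuousOn
      · intro x hx
        rw [Metric.mem_ball, dist_zero_right] at hx
        have : ‖x‖ ^ 2 < 1 := by nlinarith [norm_nonneg x]
        exact ne_of_gt (by linarith)
    have heq : Hyperboloid.ballMap '' U =
        Metric.ball 0 1 ∩ (fun x : V => (2 / (1 - ‖x‖ ^ 2)) • x) ⁻¹' U := by
      ext x
      constructor
      · rintro ⟨u, hu, rfl⟩
        refine ⟨?_, ?_⟩
        · rw [Metric.mem_ball, dist_zero_right]
          exact Hyperboloid.norm_ballMap_lt_one u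
        · rw [mem_preimage, Hyperboloid.two_div_one_sub_norm_sq_smul_ballMap]
          exact hu
      · rintro ⟨hx, hxU⟩
        rw [Metric.mem_ball, dist_zero_right] at hx
        exact ⟨_, hxU, Hyperboloid.ballMap_two_div_smul hx⟩
    rw [heq]
    exact hg.isOpen_inter_preimage Metric.isOpen_ball hU
  exact (Topology.IsOpenEmbedding.of_continuous_injective_isOpenMap hc
    Hyperboloid.ballMap_injective ho).isEmbedding

/-- **`j : ℍ⁵ → 𝔻⁵` is a smooth embedding onto the interior** (Lee 2018, Thm. 3.7 (c): the hyperbolic stereographic projection is a diffeomorphism onto the open ball; Bröcker–Jänich (13.3) for the interior of a manifold with boundary). -/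
theorem helper_rf_interiorEmbedding :
    Manifold.IsSmoothEmbedding (𝓡 5) (𝓡∂ 5) ∞ (fun u : ↥(⊤ : TopologicalSpace.Opens (EuclideanSpace ℝ (Fin 5))) => (⟨Literature.Geometry.Riemannian.Hyperboloid.ballMap (u : (EuclideanSpace ℝ (Fin 5))), mem_closedBall_zero_iff.2 (Literature.Geometry.Riemannian.Hyperboloid.norm_ballMap_lt_one (u : (EuclideanSpace ℝ (Fin 5)))).le⟩ : ↥(Metric.closedBall (0 : EuclideanSpace ℝ (Fin 5)) 1))) ∧ Set.range (fun u : ↥(⊤ : TopologicalSpace.Opens (EuclideanSpace ℝ (Fin 5))) => (⟨Literature.Geometry.Riemannian.Hyperboloid.ballMap (u : (EuclideanSpace ℝ (Fin 5))), mem_closedBall_zero_iff.2 (Literature.Geometry.Riemannian.Hyperboloid.norm_ballMap_lt_one (u : (EuclideanSpace ℝ (Fin 5)))).le⟩ : ↥(Metric.closedBall (0 : EuclideanSpace ℝ (Fin 5)) 1))) = (𝓡∂ 5).interior ↥(Metric.closedBall (0 : EuclideanSpace ℝ (Fin 5)) 1) := by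
  -- the interior of the closed ball is the open ball
  have hint : (𝓡∂ 5).interior (Metric.closedBall (0 : EuclideanSpace ℝ (Fin 5)) 1) =
      {x : (Metric.closedBall (0 : EuclideanSpace ℝ (Fin 5)) 1) |
        ‖(x : EuclideanSpace ℝ (Fin 5))‖ < 1} :=
    interior_closedBall 4
  -- the map `j` and its lift `g` to the interior manifold `Int 𝔻⁵` (a boundaryless manifold)
  set j : ↥(⊤ : TopologicalSpace.Opens (EuclideanSpace ℝ (Fin 5))) →
      (Metric.closedBall (0 : EuclideanSpace ℝ (Fin 5)) 1) :=
    fun u => (⟨Hyperboloid.ballMap (u : EuclideanSpace ℝ (Fin 5)), mem_closedBall_zero_iff.2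
      (Hyperboloid.norm_ballMap_lt_one (u : EuclideanSpace ℝ (Fin 5))).le⟩ :
        (Metric.closedBall (0 : EuclideanSpace ℝ (Fin 5)) 1))
  have hjint : ∀ u, (𝓡∂ 5).IsInteriorPoint (j u) := fun u => by
    change j u ∈ (𝓡∂ 5).interior (Metric.closedBall (0 : EuclideanSpace ℝ (Fin 5)) 1)
    rw [hint]
    exact Hyperboloid.norm_ballMap_lt_one (u : EuclideanSpace ℝ (Fin 5))
  set g : ↥(⊤ : TopologicalSpace.Opens (EuclideanSpace ℝ (Fin 5))) →
      InteriorManifold (𝓡∂ 5) (Metric.closedBall (0 : EuclideanSpace ℝ (Fin 5)) 1) :=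
    fun u => ⟨j u, hjint u⟩
  -- smoothness of `j` (tested in `ℝ⁵`) and of `g` (tested in `𝔻⁵`)
  have hjs : ContMDiff (𝓡 5) (𝓡∂ 5) ∞ j :=
    (Hyperboloid.contDiff_ballMap.contMDiff.comp contMDiff_subtype_val).codRestrict_closedBall
      (fun u : ↥(⊤ : TopologicalSpace.Opens (EuclideanSpace ℝ (Fin 5))) =>
        mem_closedBall_zero_iff.2
          (Hyperboloid.norm_ballMap_lt_one (u : EuclideanSpace ℝ (Fin 5))).le)
  have hgs : ContMDiff (𝓡 5) 𝓘(ℝ, EuclideanSpace ℝ (Fin 5)) ∞ g :=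
    (InteriorManifold.contMDiff_iff_comp_val (g := g)).2 hjs
  -- `j`, hence `g`, is a topological embedding
  have hje : Topology.IsEmbedding j :=
    (Topology.IsEmbedding.subtypeVal.of_comp_iff (f := j)).1
      (isEmbedding_ballMap.comp Topology.IsEmbedding.subtypeVal)
  have hge : Topology.IsEmbedding g :=
    (InteriorManifold.isEmbedding_val.of_comp_iff (f := g)).1 hje
  -- `g` is onto the interior manifold, so its range is open
  have hgr : range g = univ := by
    refine eq_univ_of_forall fun y => ?_
    have hy : ‖(y.val : EuclideanSpace ℝ (Fin 5))‖ < 1 := by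
      have h' : y.val ∈ (𝓡∂ 5).interior (Metric.closedBall (0 : EuclideanSpace ℝ (Fin 5)) 1) :=
        y.property
      rw [hint] at h'
      exact h'
    refine ⟨⟨(2 / (1 - ‖(y.val : EuclideanSpace ℝ (Fin 5))‖ ^ 2)) •
      (y.val : EuclideanSpace ℝ (Fin 5)), TopologicalSpace.Opens.mem_top _⟩, ?_⟩
    apply InteriorManifold.ext
    apply Subtype.ext
    exact Hyperboloid.ballMap_two_div_smul hy
  have hgo : IsOpen (range g) := by
    rw [hgr]
    exact isOpen_univ
  -- `g` is an immersion: its differential is injective, by the chain rule applied to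
  -- `Subtype.val ∘ InteriorManifold.val ∘ g = ballMap ∘ Subtype.val` (injective differential)
  have hgimm : Manifold.IsImmersion (𝓡 5) 𝓘(ℝ, EuclideanSpace ℝ (Fin 5)) ∞ g := by
    refine isImmersion_of_injective_mfderiv hgs (by simp) fun x => ?_
    have h1 : HasMFDerivAt (𝓡 5) 𝓘(ℝ, EuclideanSpace ℝ (Fin 5)) g x
        (mfderiv (𝓡 5) 𝓘(ℝ, EuclideanSpace ℝ (Fin 5)) g x) :=
      ((hgs x).mdifferentiableAt (by simp)).hasMFDerivAt
    have h2 : HasMFDerivAt 𝓘(ℝ, EuclideanSpace ℝ (Fin 5)) (𝓡∂ 5) InteriorManifold.val (g x)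
        (mfderiv 𝓘(ℝ, EuclideanSpace ℝ (Fin 5)) (𝓡∂ 5) InteriorManifold.val (g x)) :=
      ((InteriorManifold.contMDiff_val (g x)).mdifferentiableAt (by simp)).hasMFDerivAt
    have h3 : HasMFDerivAt (𝓡∂ 5) 𝓘(ℝ, EuclideanSpace ℝ (Fin 5)) Subtype.val
        ((InteriorManifold.val ∘ g) x)
        (closedBallCoeDeriv (j x) : EuclideanSpace ℝ (Fin 5) →L[ℝ] EuclideanSpace ℝ (Fin 5)) :=
      hasMFDerivAt_coe_closedBall (j x)
    have h123 : HasMFDerivAt (𝓡 5) 𝓘(ℝ, EuclideanSpace ℝ (Fin 5))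
        (Subtype.val ∘ (InteriorManifold.val ∘ g)) x
        ((closedBallCoeDeriv (j x) : EuclideanSpace ℝ (Fin 5) →L[ℝ] EuclideanSpace ℝ (Fin 5)).comp
          ((mfderiv 𝓘(ℝ, EuclideanSpace ℝ (Fin 5)) (𝓡∂ 5) InteriorManifold.val (g x)).comp
            (mfderiv (𝓡 5) 𝓘(ℝ, EuclideanSpace ℝ (Fin 5)) g x))) :=
      h3.comp x (h2.comp x h1)
    have h4 : HasMFDerivAt (𝓡 5) (𝓡 5)
        (Subtype.val : ↥(⊤ : TopologicalSpace.Opens (EuclideanSpace ℝ (Fin 5))) →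
          EuclideanSpace ℝ (Fin 5)) x
        (ContinuousLinearMap.id ℝ (EuclideanSpace ℝ (Fin 5))) :=
      OpenSubmanifold.hasMFDerivAt_subtype_val x
    have h5 : HasMFDerivAt 𝓘(ℝ, EuclideanSpace ℝ (Fin 5)) 𝓘(ℝ, EuclideanSpace ℝ (Fin 5))
        (Hyperboloid.ballMap : EuclideanSpace ℝ (Fin 5) → EuclideanSpace ℝ (Fin 5))
        (x : EuclideanSpace ℝ (Fin 5))
        (fderiv ℝ (Hyperboloid.ballMap : EuclideanSpace ℝ (Fin 5) → EuclideanSpace ℝ (Fin 5))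
          (x : EuclideanSpace ℝ (Fin 5))) :=
      (((Hyperboloid.contDiff_ballMap (V := EuclideanSpace ℝ (Fin 5))).differentiable
        (by simp)) _).hasFDerivAt.hasMFDerivAt
    have h45 : HasMFDerivAt (𝓡 5) 𝓘(ℝ, EuclideanSpace ℝ (Fin 5))
        ((Hyperboloid.ballMap : EuclideanSpace ℝ (Fin 5) → EuclideanSpace ℝ (Fin 5)) ∘
          (Subtype.val : ↥(⊤ : TopologicalSpace.Opens (EuclideanSpace ℝ (Fin 5))) →
            EuclideanSpace ℝ (Fin 5))) x
        ((fderiv ℝ (Hyperboloid.ballMap : EuclideanSpace ℝ (Fin 5) → EuclideanSpace ℝ (Fin 5))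
          (x : EuclideanSpace ℝ (Fin 5))).comp
          (ContinuousLinearMap.id ℝ (EuclideanSpace ℝ (Fin 5)))) :=
      h5.comp x h4
    have hfun : (Subtype.val ∘ (InteriorManifold.val ∘ g)) =
        (Hyperboloid.ballMap : EuclideanSpace ℝ (Fin 5) → EuclideanSpace ℝ (Fin 5)) ∘
          (Subtype.val : ↥(⊤ : TopologicalSpace.Opens (EuclideanSpace ℝ (Fin 5))) →
            EuclideanSpace ℝ (Fin 5)) := rfl
    rw [hfun] at h123
    have heq := hasMFDerivAt_unique h123 h45
    have hpt : ∀ v : EuclideanSpace ℝ (Fin 5), closedBallCoeDeriv (j x)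
        (mfderiv 𝓘(ℝ, EuclideanSpace ℝ (Fin 5)) (𝓡∂ 5) InteriorManifold.val (g x)
          (mfderiv (𝓡 5) 𝓘(ℝ, EuclideanSpace ℝ (Fin 5)) g x v)) =
        fderiv ℝ (Hyperboloid.ballMap : EuclideanSpace ℝ (Fin 5) → EuclideanSpace ℝ (Fin 5))
          (x : EuclideanSpace ℝ (Fin 5)) v :=
      fun v => DFunLike.congr_fun heq v
    intro v w hvw
    have key : fderiv ℝ (Hyperboloid.ballMap : EuclideanSpace ℝ (Fin 5) → EuclideanSpace ℝ (Fin 5))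
          (x : EuclideanSpace ℝ (Fin 5)) v =
        fderiv ℝ (Hyperboloid.ballMap : EuclideanSpace ℝ (Fin 5) → EuclideanSpace ℝ (Fin 5))
          (x : EuclideanSpace ℝ (Fin 5)) w := by
      rw [← hpt v, ← hpt w, hvw]
    exact Hyperboloid.fderiv_ballMap_injective (x : EuclideanSpace ℝ (Fin 5)) key
  -- assemble: `j = InteriorManifold.val ∘ g` is a smooth embedding into `𝔻⁵`
  have hgemb : Manifold.IsSmoothEmbedding (𝓡 5) 𝓘(ℝ, EuclideanSpace ℝ (Fin 5)) ∞ g :=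
    ⟨hgimm, hge⟩
  have hjemb : Manifold.IsSmoothEmbedding (𝓡 5) (𝓡∂ 5) ∞ (InteriorManifold.val ∘ g) :=
    InteriorManifold.isSmoothEmbedding_val_comp hgemb hgo
      (ContinuousLinearEquiv.refl ℝ (EuclideanSpace ℝ (Fin 5)))
  refine ⟨hjemb, ?_⟩
  -- the range is the open ball, i.e. the interior
  rw [hint]
  ext y
  constructor
  · rintro ⟨u, rfl⟩
    exact Hyperboloid.norm_ballMap_lt_one (u : EuclideanSpace ℝ (Fin 5))
  · intro hy
    exact ⟨⟨(2 / (1 - ‖(y : EuclideanSpace ℝ (Fin 5))‖ ^ 2)) • (y : EuclideanSpace ℝ (Fin 5)),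
      TopologicalSpace.Opens.mem_top _⟩, Subtype.ext (Hyperboloid.ballMap_two_div_smul hy)⟩

end Summit.SmoothPoincare4.SmoothPoincare4.Cruxes.PEFillNearRound.RoundFilled

end
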